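import Summits.Ventures.PercRepro.ProfilePointedUniformRestrictionRow

/-!
# PercRepro — UNIFORMITY IS AUTOMATIC: EVERY `U_{r,2r}`-RESTRICTION IS UNIFORM, SO A MINIMAL (Ĉ)-WITNESS HAS NO `2r`
POINTS OF RANK `r` IN GENERAL POSITION — IN PARTICULAR NO 4-POINT LINE (p10, gen 24; modulo Theorem A = the named fact)

The `uniform` field of `UniformRestriction` (ProfilePointedUniformRestriction) — the independence of `X ∪ T`, `X ⊆ E ∖ L`,
does not depend on the `r`-subset `T ⊆ L` — is IMPLIED by the other fields: an `r`-subset `T` of the rank-`r` set `L`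
spans `L`, so `ρ(X ∪ T) = ρ(X ∪ L)` for every `X` (`rk_union_eq_of_rk_eq`, by submodularity with `(X ∪ T) ∩ L = T`), and
`X ∪ T` is independent iff `ρ(X ∪ L) = #X + r`, whatever `T` (`uniformRestriction_of_rk`).  Hence EVERY `U_{r,2r}`-restriction
of `N` — a `2r`-set of rank `r` all of whose `r`-subsets are independent — splits the profile as in ProfilePointedUniformRestriction,
carries (Ĉ) at each of its points from Theorem A alone, and reduces (Ĉ) at the other points to `N / T ∖ (L ∖ T)`:

* `MinimalWitness.not_unif` — a minimal (Ĉ)-witness has no `U_{r,2r}`-restriction for any `r ≥ 1`;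
* `MinimalWitness.card_le_three_of_rk_two` — EVERY LINE OF A MINIMAL (Ĉ)-WITNESS HAS AT MOST THREE POINTS: a set of rank
  `2` in a minimal witness has at most `3` elements (the witness is simple — gen 23 —, so any four of its points of rank `2`
  form a `U_{2,4}`-restriction).

With gens 13–23: a minimal witness, if any, is loopless, coloop-free, simple, connected, and has no `4`-point line; the two
residue classes of gen 23's census on ≤ 9 elements (the line points of `U_{m,m+1} ⊕₂ U_{2,5}` and of `P(U_{m,m+1}, U_{2,4})`)
are exactly instances at a `4`-point line.  Nothing here asserts (Ĉ).
-/

open scoped Matroid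

namespace PercRepro.Cogirth

open Finset ThmH Skew

variable {α : Type} [DecidableEq α] {N : Matroid α} [N.Finite]

section automatic

variable {L : Finset α} {r : ℕ}

/-- A subset `T` of `L` of the same rank spans `L`: `ρ(X ∪ T) = ρ(X ∪ L)` for every `X` avoiding `L`
(submodularity with `(X ∪ T) ∩ L = T`). -/
theorem rk_union_eq_of_rk_eq {T : Finset α} (hTL : T ⊆ L) (hT : rk N T = rk N L) {X : Finset α}
    (hXL : Disjoint X L) : rk N (X ∪ T) = rk N (X ∪ L) := by
  apply le_antisymm (rk_mono' (union_subset_union_right hTL))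
  have hsub := rk_inter_add_rk_union_le' (M := N) (X ∪ T) L
  have e1 : (X ∪ T) ∩ L = T := by
    rw [union_inter_distrib_right, inter_eq_left.2 hTL, disjoint_iff_inter_eq_empty.1 hXL, empty_union]
  have e2 : X ∪ T ∪ L = X ∪ L := by
    rw [union_assoc, union_eq_right.2 hTL]
  rw [e1, e2, hT] at hsub
  omega

/-- **Uniformity is automatic**: a `2r`-set `L ⊆ E` of rank `r` all of whose `r`-subsets are independent is a uniform
`U_{r,2r}`-restriction — `X ∪ T` is independent iff `ρ(X ∪ L) = #X + r`, whatever the `r`-subset `T`. -/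
theorem uniformRestriction_of_rk (hLg : L ⊆ gr N) (hLc : L.card = 2 * r) (hLr : rk N L = r)
    (hsub : ∀ T ∈ L.powersetCard r, rk N T = r) : UniformRestriction N L r := by
  refine ⟨hLg, hLc, hLr, hsub, ?_⟩
  intro X hX T hT T' hT' h
  have hXL : Disjoint X L := disjoint_left.2 (fun x hx hxL => (mem_sdiff.1 (hX hx)).2 hxL)
  obtain ⟨hTL, hTc⟩ := mem_powersetCard.1 hT
  obtain ⟨hT'L, hT'c⟩ := mem_powersetCard.1 hT'
  have hXT : Disjoint X T := disjoint_left.2 (fun x hx hxT => (mem_sdiff.1 (hX hx)).2 (hTL hxT))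
  have hXT' : Disjoint X T' := disjoint_left.2 (fun x hx hxT => (mem_sdiff.1 (hX hx)).2 (hT'L hxT))
  rw [rk_union_eq_of_rk_eq hTL (by rw [hsub T hT, hLr]) hXL, card_union_of_disjoint hXT, hTc] at h
  rw [rk_union_eq_of_rk_eq hT'L (by rw [hsub T' hT', hLr]) hXL, card_union_of_disjoint hXT', hT'c]
  exact h

/-- **A minimal (Ĉ)-witness has no `U_{r,2r}`-restriction** (CONDITIONAL on the named fact): no `2r` points of rank
`r` all of whose `r`-subsets are independent, for any `r ≥ 1`. -/
theorem MinimalWitness.not_unif (hfact : BiIndepDensityLogConcave α) {p : α} (h : MinimalWitness N p) (hr : 1 ≤ r)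
    (hLg : L ⊆ gr N) (hLc : L.card = 2 * r) (hLr : rk N L = r) (hsub : ∀ T ∈ L.powersetCard r, rk N T = r) :
    False :=
  h.not_uniformRestriction hfact hr (uniformRestriction_of_rk hLg hLc hLr hsub)

/-- Two distinct points of a minimal witness have rank `2` (the witness is loopless and has no parallel pair,
gen 23; CONDITIONAL on the named fact). -/
theorem MinimalWitness.rk_pair (hfact : BiIndepDensityLogConcave α) {p : α} (h : MinimalWitness N p) {x y : α}
    (hx : x ∈ gr N) (hy : y ∈ gr N) (hxy : x ≠ y) : rk N {x, y} = 2 := by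
  have h1 := h.not_parallel hfact hx hy hxy
  have h2 := h.loopless hx
  have h3 : rk N {x} ≤ rk N {x, y} := rk_mono' (singleton_subset_iff.2 (mem_insert_self x {y}))
  have h4 := rk_le_card (M := N) ({x, y} : Finset α)
  rw [card_pair hxy] at h4
  omega

/-- **EVERY LINE OF A MINIMAL (Ĉ)-WITNESS HAS AT MOST THREE POINTS** (CONDITIONAL on the named fact): a set of rank
`2` in a minimal witness has at most `3` elements — any four of them would be a `U_{2,4}`-restriction. -/
theorem MinimalWitness.card_le_three_of_rk_two (hfact : BiIndepDensityLogConcave α) {p : α}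
    (h : MinimalWitness N p) (hLg : L ⊆ gr N) (hLr : rk N L = 2) : L.card ≤ 3 := by
  by_contra hlt
  obtain ⟨L', hL'L, hL'c⟩ := exists_subset_card_eq (show 4 ≤ L.card by omega)
  have hL'g : L' ⊆ gr N := hL'L.trans hLg
  have hpairs : ∀ T ∈ L'.powersetCard 2, rk N T = 2 := by
    intro T hT
    obtain ⟨hTL, hTc⟩ := mem_powersetCard.1 hT
    obtain ⟨x, y, hxy, rfl⟩ := card_eq_two.1 hTc
    exact h.rk_pair hfact (hL'g (hTL (mem_insert_self x {y}))) (hL'g (hTL (mem_insert_of_mem (mem_singleton_self y))))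
      hxy
  have hL'r : rk N L' = 2 := by
    apply le_antisymm (hLr ▸ rk_mono' hL'L)
    obtain ⟨T, hTL, hTc⟩ := exists_subset_card_eq (show 2 ≤ L'.card by omega)
    rw [← hpairs T (mem_powersetCard.2 ⟨hTL, hTc⟩)]
    exact rk_mono' hTL
  exact h.not_unif hfact (by norm_num) hL'g (by rw [hL'c]) hL'r hpairs

end automatic

end PercRepro.Cogirth
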